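import Summits.AtomisticToContinuum.BoseEinsteinCondensation.Theorems.BECInsertionCorrectorStaticResponseBoundGaugedSquareIdentity
import Literature.MathematicalPhysics.QuantumManyBody.GroundStateDirichletForm
import HarnessLib

/-!
# The gauged completed square for the static response bound, II: the stub

Stub `stub_gaugedSquare` (verbatim `GaugedSquare`) of the few-body layer of line
`stable-fraction-square-completion` of crux `BECInsertionCorrector.StaticResponseBound`
(item stmt-AtomisticToContinuum-12057; this file supports, does not close, the item).

For every pair profile `v`, every `N`, `L > 0`, `k ≠ 0`, every coupling `t` and every
finite-energy periodic trial state `Ψ`,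

  `e^{-4|t|N/|p|²} E₀(v,N,L) − N t²/|p|² ≤ E_v(Ψ) + t ⟨∑ⱼ cos(p·xⱼ)⟩_Ψ`,  `|p|² = psq L k`.

Proof (the gauged version of `stub_freeSquare`, which drops the square and gets `−Nt²/|p|²`).
Put `S = (t/|p|²) ∑ⱼ cos(p·xⱼ)` (`|S| ≤ |t|N/|p|²`), `m = e^{-2|t|N/|p|²}` and gauge `Ψ = e^{-S} G`,
`G = e^{S}Ψ` (`C¹`, `Lℤ³`-periodic, Bose-symmetric, `m ≤ |G|²/|Ψ|² = e^{2S} ≤ 1/m`). By part I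
(`gaugedSq_sum`, `gaugedSq_fderiv_gauge`) the completed square is kept in the form
`∫ e^{-2S}|∇G|² − N t²/|p|² ≤ ∫|∇Ψ|² + t⟨∑cos⟩_Ψ`, and `∫ e^{-2S}|∇G|² ≥ m ∫|∇G|²`; the interaction is
gauge invariant up to the same factor, `∫ V|Ψ|² = ∫ V e^{-2S}|G|² ≥ m ∫ V|G|²` (`V = ∑_{i<j} v^per ≥ 0`,
possibly `⊤` on a null set: we work in `ℝ≥0∞` there, using the finite energy of `Ψ`). The variational
principle for the normalised `G` (`gaugedSq_groundState_mul_le`) gives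
`∫|∇G|² + ∫V|G|² ≥ E₀ ∫|G|² ≥ E₀ m` (`∫|G|² = ∫e^{2S}|Ψ|² ≥ m`), whence
`E_v(Ψ) + t⟨∑cos⟩_Ψ ≥ m² E₀ − N t²/|p|²`. No smallness, no `v`-dependence; `k ≠ 0` enters only
through `|p|² > 0`.

All ingredients are folklore (gauge transform / ground-state substitution on the torus).
-/

noncomputable section

namespace Summit.AtomisticToContinuum.BoseEinsteinCondensation.Cruxes.StaticResponseBound.FewBody

open MeasureTheory Filter
open scoped ENNReal NNReal BigOperators RealInnerProductSpace
open Literature.MathematicalPhysics.QuantumManyBody.BoseGas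
open Summit.AtomisticToContinuum.BoseEinsteinCondensation.Theses.BECInsertionCorrector
open Summit.AtomisticToContinuum.BoseEinsteinCondensation.Theorems.StaticResponseBound.Negative
open Summit.AtomisticToContinuum.BoseEinsteinCondensation.Cruxes.StaticResponseBound.UvThomsonForceWave

variable {N : ℕ}

/-! ## The variational principle for an unnormalised function -/

/-- **Variational principle for an unnormalised function.** For a `C¹`, `Lℤ³`-periodic,
Bose-symmetric `G` with `0 < ∫_cell |G|² < ∞`:
`E₀(v,N,L) · ∫_cell |G|² ≤ ∫_cell (|∇G|² + ∑_{i<j} v^per |G|²)` (normalise `G`, `PeriodicTrialState.ofFun`,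
and scale the quadratic form). [folklore] -/
theorem gaugedSq_groundState_mul_le (v : ℝ → ℝ≥0∞) {L : ℝ} (G : Config N → ℂ) (hC : ContDiff ℝ 1 G)
    (hper : ∀ (X : Config N) (i : Fin N) (a : Fin 3),
      G (X + Pi.single i (EuclideanSpace.single a L)) = G X)
    (hsymm : ∀ (σ : Equiv.Perm (Fin N)) (X : Config N), G (X ∘ σ) = G X)
    (h0 : ∫⁻ X in cellN N L, ((‖G X‖₊ : ℝ≥0∞)) ^ 2 ≠ 0)
    (htop : ∫⁻ X in cellN N L, ((‖G X‖₊ : ℝ≥0∞)) ^ 2 ≠ ⊤) :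
    periodicGroundStateEnergy v N L * ∫⁻ X in cellN N L, ((‖G X‖₊ : ℝ≥0∞)) ^ 2 ≤
      ∫⁻ X in cellN N L, kineticDensity G X + periodicInteraction v L X * ((‖G X‖₊ : ℝ≥0∞)) ^ 2 := by
  set I := ∫⁻ X in cellN N L, ((‖G X‖₊ : ℝ≥0∞)) ^ 2 with hI
  set Φ := PeriodicTrialState.ofFun G hC hper hsymm h0 htop with hΦ
  have hIpos : 0 < I.toReal := ENNReal.toReal_pos h0 htop
  have hc2 : ((‖((Real.sqrt I.toReal)⁻¹ : ℂ)‖₊ : ℝ≥0∞)) ^ 2 = I⁻¹ := by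
    rw [coe_nnnorm_sq_eq_ofReal, norm_inv, Complex.norm_real,
      Real.norm_of_nonneg (Real.sqrt_nonneg _), inv_pow, Real.sq_sqrt hIpos.le,
      ENNReal.ofReal_inv_of_pos hIpos, ENNReal.ofReal_toReal htop]
  have hE : periodicEnergy v Φ = I⁻¹ *
      ∫⁻ X in cellN N L, kineticDensity G X + periodicInteraction v L X * ((‖G X‖₊ : ℝ≥0∞)) ^ 2 := by
    unfold periodicEnergy
    rw [← lintegral_const_mul' _ _ (ENNReal.inv_ne_top.2 h0)]
    refine lintegral_congr fun X => ?_
    have hψ : Φ.ψ = fun Y => ((Real.sqrt I.toReal)⁻¹ : ℂ) * G Y := rfl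
    rw [hψ, kineticDensity_const_mul_complex]
    dsimp only
    rw [nnnorm_mul, ENNReal.coe_mul, mul_pow, hc2]
    ring
  calc periodicGroundStateEnergy v N L * I ≤ periodicEnergy v Φ * I :=
        mul_le_mul_left (periodicGroundStateEnergy_le v Φ) I
    _ = _ := by
        rw [hE, mul_comm I⁻¹, mul_assoc, ENNReal.inv_mul_cancel h0 htop, mul_one]

/-! ## The stub -/

/-- **The gauged free completed square** (stub `stub_gaugedSquare`, verbatim `GaugedSquare` of
the few-body layer of line `stable-fraction-square-completion`): for every pair profile `v`,
`N`, `L > 0`, `k ≠ 0`, `t` and every finite-energy periodic trial state `Ψ`,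
`e^{-4|t|N/|p|²} E₀(v,N,L) − N t²/|p|² ≤ E_v(Ψ) + t ⟨∑ⱼ cos(p·xⱼ)⟩_Ψ`.
Proof: gauge `Ψ = e^{-S} G`, `S = (t/|p|²)∑ⱼ cos(p·xⱼ)`, `|S| ≤ |t|N/|p|²`; the completed square
`∫ ∑_{j,c}|∂_{j,c}Ψ − u_c sin θⱼ Ψ|² = ∫ e^{-2S}|∇G|²` is KEPT (`gaugedSq_sum`, `gaugedSq_fderiv_gauge`) and
bounded below, together with the interaction `∫ V|Ψ|² = ∫ e^{-2S} V|G|²`, by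
`e^{-2|t|N/|p|²}(∫|∇G|² + ∫V|G|²) ≥ e^{-2|t|N/|p|²} E₀ ∫|G|²` (`gaugedSq_groundState_mul_le`), and
`∫|G|² = ∫ e^{2S}|Ψ|² ≥ e^{-2|t|N/|p|²}`. [folklore] -/
theorem stub_gaugedSquare :
    ∀ (v : ℝ → ℝ≥0∞) (N : ℕ) (L : ℝ), 0 < L → ∀ (k : Fin 3 → ℤ), k ≠ 0 →
      ∀ (t : ℝ) (Ψ : PeriodicTrialState N L), periodicEnergy v Ψ ≠ ⊤ →
        Real.exp (-(4 * |t| * N / psq L k)) * (periodicGroundStateEnergy v N L).toReal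
            - (N : ℝ) * t ^ 2 / psq L k
          ≤ (periodicEnergy v Ψ).toReal + t * cosMean L k Ψ := by
  intro v N L hL k hk t Ψ hE
  have hP : 0 < psq L k := freeSq_psq_pos hL hk
  -- the phases, the gauge `S`, the gauged function `G`, the square density and the kinetic density
  choose Θ hΘ using fun j => freeSq_phase_clm (N := N) L k j
  obtain ⟨u, hu⟩ : ∃ u : Fin 3 → ℝ, ∀ c, u c = t * (2 * Real.pi / L * k c) / psq L k :=
    ⟨_, fun _ => rfl⟩
  obtain ⟨S, hS⟩ : ∃ S : Config N → ℝ, ∀ X, S X = t / psq L k * ∑ j, Real.cos (Θ j X) :=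
    ⟨_, fun _ => rfl⟩
  obtain ⟨G, hG⟩ : ∃ G : Config N → ℂ, ∀ X, G X = Real.exp (S X) • Ψ.ψ X := ⟨_, fun _ => rfl⟩
  obtain ⟨sqd, hsq⟩ : ∃ sqd : Config N → ℝ, ∀ X, sqd X = ∑ j, ∑ c,
      ‖fderiv ℝ Ψ.ψ X (Pi.single j (EuclideanSpace.single c 1))
        - (u c * Real.sin (Θ j X)) • Ψ.ψ X‖ ^ 2 := ⟨_, fun _ => rfl⟩
  obtain ⟨kin, hkin⟩ : ∃ kin : Config N → ℝ, ∀ X, kin X = ∑ j, ∑ c,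
      ‖fderiv ℝ Ψ.ψ X (Pi.single j (EuclideanSpace.single c 1))‖ ^ 2 := ⟨_, fun _ => rfl⟩
  -- the constant `m = e^{-2|t|N/|p|²}` and the bounds `m ≤ e^{2S} ≤ 1/m`
  set B : ℝ := |t| * N / psq L k with hB
  set m : ℝ := Real.exp (-2 * B) with hm
  have hm0 : 0 < m := Real.exp_pos _
  have hSabs : ∀ X, |S X| ≤ B := by
    intro X
    rw [hS, abs_mul, abs_div, abs_of_pos hP]
    calc |t| / psq L k * |∑ j, Real.cos (Θ j X)| ≤ |t| / psq L k * N := by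
          refine mul_le_mul_of_nonneg_left ?_ (by positivity)
          calc |∑ j, Real.cos (Θ j X)| ≤ ∑ j, |Real.cos (Θ j X)| := Finset.abs_sum_le_sum_abs _ _
            _ ≤ ∑ _j : Fin N, (1 : ℝ) := Finset.sum_le_sum fun j _ => Real.abs_cos_le_one _
            _ = N := by simp
      _ = B := by rw [hB]; ring
  have hexpsq : ∀ X, Real.exp (S X) ^ 2 = Real.exp (2 * S X) := fun X => by
    rw [sq, ← Real.exp_add, two_mul]
  have hexp1 : ∀ X, m * Real.exp (S X) ^ 2 ≤ 1 := by
    intro X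
    rw [hexpsq, hm, ← Real.exp_add, Real.exp_le_one_iff]
    linarith [(le_abs_self (S X)).trans (hSabs X)]
  have hexp2 : ∀ X, m ≤ Real.exp (S X) ^ 2 := by
    intro X
    rw [hexpsq, hm, Real.exp_le_exp]
    linarith [(neg_abs_le (S X)).trans' (neg_le_neg (hSabs X))]
  -- regularity of `Ψ`, `S`, `G`
  have hψ1 : ContDiff ℝ 1 Ψ.ψ := Ψ.contDiff
  have hψd : Differentiable ℝ Ψ.ψ := hψ1.differentiable one_ne_zero
  have hψc : Continuous Ψ.ψ := hψ1.continuous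
  have hcf : Continuous (fderiv ℝ Ψ.ψ) := hψ1.continuous_fderiv one_ne_zero
  have hS1 : ContDiff ℝ 1 S := by
    rw [(funext hS : S = _)]
    exact contDiff_const.mul (ContDiff.sum fun j _ => Real.contDiff_cos.comp (Θ j).contDiff)
  have hSc : Continuous S := hS1.continuous
  have hG1 : ContDiff ℝ 1 G := by
    rw [(funext hG : G = _)]
    exact (Real.contDiff_exp.comp hS1).smul hψ1
  have hGper : ∀ (X : Config N) (i : Fin N) (a : Fin 3),
      G (X + Pi.single i (EuclideanSpace.single a L)) = G X := by
    intro X i a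
    have hSper : S (X + Pi.single i (EuclideanSpace.single a L)) = S X := by
      rw [hS, hS]
      congr 1
      refine Finset.sum_congr rfl fun j _ => ?_
      obtain ⟨n, hn⟩ := gaugedSq_phase_period hL.ne' (Θ j) (hΘ j) i a
      rw [map_add, hn, Real.cos_add_int_mul_two_pi]
    rw [hG, hG, Ψ.periodic, hSper]
  have hGsymm : ∀ (σ : Equiv.Perm (Fin N)) (X : Config N), G (X ∘ σ) = G X := by
    intro σ X
    have hSsymm : S (X ∘ σ) = S X := by
      rw [hS, hS]
      congr 1
      simp only [hΘ, Function.comp_apply]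
      exact Equiv.sum_comp σ (fun j => Real.cos (2 * Real.pi / L * ∑ i, (k i : ℝ) * X j i))
    rw [hG, hG, Ψ.symm, hSsymm]
  have hGsq : ∀ X, ‖G X‖ ^ 2 = Real.exp (S X) ^ 2 * ‖Ψ.ψ X‖ ^ 2 := by
    intro X
    rw [hG, norm_smul, Real.norm_eq_abs, abs_of_pos (Real.exp_pos _), mul_pow]
  -- the kinetic densities: `|∇Ψ|² = kin`, `|∇G|² = e^{2S} sq`
  have hkinΨ : ∀ X, kineticDensity Ψ.ψ X = ENNReal.ofReal (kin X) := by
    intro X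
    rw [hkin, kineticDensity, ENNReal.ofReal_sum_of_nonneg fun j _ =>
      Finset.sum_nonneg fun c _ => sq_nonneg _]
    refine Finset.sum_congr rfl fun j _ => ?_
    rw [ENNReal.ofReal_sum_of_nonneg fun c _ => sq_nonneg _]
    exact Finset.sum_congr rfl fun c _ => coe_nnnorm_sq_eq_ofReal _
  have hkinG : ∀ X, kineticDensity G X = ENNReal.ofReal (Real.exp (S X) ^ 2 * sqd X) := by
    intro X
    rw [hsq, Finset.mul_sum, kineticDensity, ENNReal.ofReal_sum_of_nonneg fun j _ =>
      mul_nonneg (sq_nonneg _) (Finset.sum_nonneg fun c _ => sq_nonneg _)]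
    refine Finset.sum_congr rfl fun j _ => ?_
    rw [Finset.mul_sum, ENNReal.ofReal_sum_of_nonneg fun c _ => mul_nonneg (sq_nonneg _) (sq_nonneg _)]
    refine Finset.sum_congr rfl fun c _ => ?_
    rw [coe_nnnorm_sq_eq_ofReal, gaugedSq_fderiv_gauge t (psq L k) hψd Θ hΘ hS hG X j c, norm_smul,
      mul_pow, Real.norm_eq_abs, sq_abs, hu]
  -- continuity and integrability of the real densities
  have hsq0 : ∀ X, 0 ≤ sqd X := fun X => by
    rw [hsq]; exact Finset.sum_nonneg fun j _ => Finset.sum_nonneg fun c _ => sq_nonneg _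
  have hkin0 : ∀ X, 0 ≤ kin X := fun X => by
    rw [hkin]; exact Finset.sum_nonneg fun j _ => Finset.sum_nonneg fun c _ => sq_nonneg _
  have hsqc : Continuous sqd := by
    rw [(funext hsq : sqd = _)]
    refine continuous_finsetSum _ fun j _ => continuous_finsetSum _ fun c _ => ?_
    exact ((hcf.clm_apply continuous_const).sub
      ((continuous_const.mul (Real.continuous_sin.comp (Θ j).continuous)).smul hψc)).norm.pow 2
  have hkinc : Continuous kin := by
    rw [(funext hkin : kin = _)]
    exact continuous_finsetSum _ fun j _ => continuous_finsetSum _ fun c _ =>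
      (hcf.clm_apply continuous_const).norm.pow 2
  have hesqc : Continuous fun X => Real.exp (S X) ^ 2 * sqd X :=
    ((Real.continuous_exp.comp hSc).pow 2).mul hsqc
  have hIsq : Integrable sqd (volume.restrict (cellN N L)) := integrableOn_cellN hsqc L
  have hIkin : Integrable kin (volume.restrict (cellN N L)) := integrableOn_cellN hkinc L
  have hIesq : Integrable (fun X => Real.exp (S X) ^ 2 * sqd X) (volume.restrict (cellN N L)) :=
    integrableOn_cellN hesqc L
  -- (1) the energy of `Ψ` in real form: `E = K + U`
  set K : ℝ := ∫ X in cellN N L, kin X with hK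
  set U : ℝ≥0∞ := ∫⁻ X in cellN N L, periodicInteraction v L X * ((‖Ψ.ψ X‖₊ : ℝ≥0∞)) ^ 2 with hU
  have hK0 : 0 ≤ K := integral_nonneg hkin0
  have hkinΨ_lint : ∫⁻ X in cellN N L, kineticDensity Ψ.ψ X = ENNReal.ofReal K := by
    rw [show (∫⁻ X in cellN N L, kineticDensity Ψ.ψ X) = ∫⁻ X in cellN N L, ENNReal.ofReal (kin X)
      from lintegral_congr fun X => hkinΨ X]
    exact (ofReal_integral_eq_lintegral_ofReal hIkin (Eventually.of_forall hkin0)).symm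
  have hEsplit : periodicEnergy v Ψ = ENNReal.ofReal K + U := by
    have hmeas : Measurable (kineticDensity Ψ.ψ) := by
      rw [(funext hkinΨ : kineticDensity Ψ.ψ = _)]; exact hkinc.measurable.ennreal_ofReal
    unfold periodicEnergy
    rw [lintegral_add_left hmeas, hkinΨ_lint]
  have hUtop : U ≠ ⊤ := by
    intro h; apply hE; rw [hEsplit, h, add_top]
  have hEreal : (periodicEnergy v Ψ).toReal = K + U.toReal := by
    rw [hEsplit, ENNReal.toReal_add ENNReal.ofReal_ne_top hUtop, ENNReal.toReal_ofReal hK0]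
  -- (2) the completed square, summed: `∫ sq - N t²/|p|² ≤ K + t⟨∑cos⟩`
  have h2 : (∫ X in cellN N L, sqd X) - N * t ^ 2 / psq L k ≤ K + t * cosMean L k Ψ :=
    gaugedSq_sum hL hk t Ψ Θ hΘ hu hsq hkin
  -- (3) the kinetic energy of `G`: `m ∫ e^{2S} sq ≤ ∫ sq`
  set KG : ℝ := ∫ X in cellN N L, Real.exp (S X) ^ 2 * sqd X with hKG
  have hKG0 : 0 ≤ KG := integral_nonneg fun X => mul_nonneg (sq_nonneg _) (hsq0 X)
  have h3 : m * KG ≤ ∫ X in cellN N L, sqd X := by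
    rw [hKG, ← integral_const_mul]
    refine integral_mono (hIesq.const_mul m) hIsq fun X => ?_
    dsimp only
    calc m * (Real.exp (S X) ^ 2 * sqd X) = (m * Real.exp (S X) ^ 2) * sqd X := by ring
      _ ≤ 1 * sqd X := mul_le_mul_of_nonneg_right (hexp1 X) (hsq0 X)
      _ = sqd X := one_mul _
  have hkinG_lint : ∫⁻ X in cellN N L, kineticDensity G X = ENNReal.ofReal KG := by
    rw [show (∫⁻ X in cellN N L, kineticDensity G X) =
      ∫⁻ X in cellN N L, ENNReal.ofReal (Real.exp (S X) ^ 2 * sqd X) from lintegral_congr fun X => hkinG X]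
    exact (ofReal_integral_eq_lintegral_ofReal hIesq
      (Eventually.of_forall fun X => mul_nonneg (sq_nonneg _) (hsq0 X))).symm
  -- (4) the interaction of `G`: `m ∫ V|G|² ≤ ∫ V|Ψ|² = U`
  set UG : ℝ≥0∞ := ∫⁻ X in cellN N L, periodicInteraction v L X * ((‖G X‖₊ : ℝ≥0∞)) ^ 2 with hUG
  have h4E : ENNReal.ofReal m * UG ≤ U := by
    rw [hUG, ← lintegral_const_mul' _ _ ENNReal.ofReal_ne_top]
    refine lintegral_mono fun X => ?_
    rw [mul_left_comm]
    refine mul_le_mul_right ?_ _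
    rw [coe_nnnorm_sq_eq_ofReal, coe_nnnorm_sq_eq_ofReal, ← ENNReal.ofReal_mul hm0.le, hGsq]
    refine ENNReal.ofReal_le_ofReal ?_
    calc m * (Real.exp (S X) ^ 2 * ‖Ψ.ψ X‖ ^ 2) = (m * Real.exp (S X) ^ 2) * ‖Ψ.ψ X‖ ^ 2 := by ring
      _ ≤ 1 * ‖Ψ.ψ X‖ ^ 2 := mul_le_mul_of_nonneg_right (hexp1 X) (sq_nonneg _)
      _ = ‖Ψ.ψ X‖ ^ 2 := one_mul _
  have hm0' : ENNReal.ofReal m ≠ 0 := (ENNReal.ofReal_pos.2 hm0).ne'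
  have hUGtop : UG ≠ ⊤ := by
    intro h
    rw [h, ENNReal.mul_top hm0'] at h4E
    exact hUtop (top_le_iff.1 h4E)
  have h4 : m * UG.toReal ≤ U.toReal := by
    have := ENNReal.toReal_mono hUtop h4E
    rwa [ENNReal.toReal_mul, ENNReal.toReal_ofReal hm0.le] at this
  -- (5) the norm of `G` and the variational principle: `m E₀ ≤ E₀ ∫|G|² ≤ KG + UG`
  set I : ℝ≥0∞ := ∫⁻ X in cellN N L, ((‖G X‖₊ : ℝ≥0∞)) ^ 2 with hI
  have hIge : ENNReal.ofReal m ≤ I := by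
    calc ENNReal.ofReal m = ENNReal.ofReal m * ∫⁻ X in cellN N L, ((‖Ψ.ψ X‖₊ : ℝ≥0∞)) ^ 2 := by
          rw [Ψ.norm_eq, mul_one]
      _ = ∫⁻ X in cellN N L, ENNReal.ofReal m * ((‖Ψ.ψ X‖₊ : ℝ≥0∞)) ^ 2 :=
          (lintegral_const_mul' _ _ ENNReal.ofReal_ne_top).symm
      _ ≤ I := lintegral_mono fun X => by
          rw [coe_nnnorm_sq_eq_ofReal, coe_nnnorm_sq_eq_ofReal, ← ENNReal.ofReal_mul hm0.le, hGsq]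
          exact ENNReal.ofReal_le_ofReal (mul_le_mul_of_nonneg_right (hexp2 X) (sq_nonneg _))
  have hI0 : I ≠ 0 := (lt_of_lt_of_le (ENNReal.ofReal_pos.2 hm0) hIge).ne'
  have hItop : I ≠ ⊤ := by
    have hint := integrableOn_cellN (f := fun X => ‖G X‖ ^ 2) ((hG1.continuous.norm).pow 2) L
    refine ne_of_lt (lt_of_le_of_lt (le_of_eq (lintegral_congr fun X => ?_)) hint.2)
    rw [coe_nnnorm_sq_eq_ofReal, Real.enorm_eq_ofReal (sq_nonneg _)]
  have hIreal : m ≤ I.toReal := by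
    have := ENNReal.toReal_mono hItop hIge
    rwa [ENNReal.toReal_ofReal hm0.le] at this
  have hvar := gaugedSq_groundState_mul_le v G hG1 hGper hGsymm hI0 hItop
  have hQ : (∫⁻ X in cellN N L, kineticDensity G X + periodicInteraction v L X * ((‖G X‖₊ : ℝ≥0∞)) ^ 2) =
      ENNReal.ofReal KG + UG := by
    have hmeas : Measurable (kineticDensity G) := by
      rw [(funext hkinG : kineticDensity G = _)]; exact hesqc.measurable.ennreal_ofReal
    rw [lintegral_add_left hmeas, hkinG_lint]
  rw [hQ] at hvar
  have hQtop : ENNReal.ofReal KG + UG ≠ ⊤ := ENNReal.add_ne_top.2 ⟨ENNReal.ofReal_ne_top, hUGtop⟩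
  have h5 : (periodicGroundStateEnergy v N L).toReal * I.toReal ≤ KG + UG.toReal := by
    have := ENNReal.toReal_mono hQtop hvar
    rwa [ENNReal.toReal_mul, ENNReal.toReal_add ENNReal.ofReal_ne_top hUGtop,
      ENNReal.toReal_ofReal hKG0] at this
  have hE0 : 0 ≤ (periodicGroundStateEnergy v N L).toReal := ENNReal.toReal_nonneg
  have h5' : m * (periodicGroundStateEnergy v N L).toReal ≤ KG + UG.toReal := by
    have := mul_le_mul_of_nonneg_left hIreal hE0
    linarith [mul_comm m (periodicGroundStateEnergy v N L).toReal]
  -- (6) assemble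
  have hm2 : Real.exp (-(4 * |t| * N / psq L k)) = m * m := by
    rw [hm, ← Real.exp_add]; congr 1; rw [hB]; ring
  have h6 := mul_le_mul_of_nonneg_left h5' hm0.le
  rw [mul_add, ← mul_assoc] at h6
  rw [hm2, hEreal]
  linarith

end Summit.AtomisticToContinuum.BoseEinsteinCondensation.Cruxes.StaticResponseBound.FewBody

end
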